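import Mathlib
import Summits.ValiantsHypothesis.ValiantsHypothesis.Theorems.GeneratorObstructionsPowGenDegreeQPCholeskyDensity
import Summits.ValiantsHypothesis.ValiantsHypothesis.Theorems.GeneratorObstructionsPowGenDegreeQPWideAtoms

/-!
# K2 `PowGenDegreeQP` (stmt-ValiantsHypothesis-11655), line `trace-side-regimes`:
# the generator types of the orbit closure of a full-rank quadric are EXACTLY the fundamental
# weights `-2·𝟙_{≥ t}`

Helper file (`--supports stmt-ValiantsHypothesis-11655`).  Packaging of the row-`m = 2` machinery
(`…BorelDense`, `…RowTwoReduction`, `…TraceTwoDiagonal`, `…QuadricGram`, `…CholeskyDensity`) into an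
unconditional two-sided description, for ANY form `f` over `ℂ` that some `h₀ ∈ GL` moves to a
full-rank diagonal quadric `h₀ · f = ∑_u c_u X_u²` (`c_u ≠ 0`) — e.g. `tr X_n²`, `per_2`, `det_2`, every
nondegenerate quadratic form:

* `genType_iff_fundamental_of_linSubstRep_eq_diagonal` — `γ_χ(f) ≠ 0 ⟺ χ = 0 ∨ χ = -2·𝟙_{≥ t}` for
  some letter `t` (⇒: gen1's `genType_eq_zero_or_fundamental` with its three inputs discharged;
  ⇐: `-2·𝟙_{≥ t}` occurs (`hfund`) and is an ATOM of the occurrence monoid — occurring weights are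
  even, antitone and nonpositive, so a splitting has a zero part — hence a generator type,
  `finrank_quotient_ne_zero_of_atom`; the weight `0` is degenerately a generator type, `γ_0 = 1`,
  `finrank_quotient_zero_ne_zero`, in every `k[Δ_m f]`);
* `genType_iff_fundamental_powFormLex_two` — the case `f = tr X_n²`: the generator types of
  `A(Δ_2(tr X_n²))` are exactly `0` and the `n²` weights `-2·𝟙_{≥ t}`, of degrees
  `#{u ≥ t} ∈ {1,…,n²}`.

Honest label: classical (`k[Sym² ℂ^N]^U = k[Δ_1,…,Δ_N]`, Goodman–Wallach §5.7), now kernel-checked in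
the tree's `γ` language; rows `m ≥ 3` of both registered stubs OPEN.
-/

namespace Summit.ValiantsHypothesis.ValiantsHypothesis.Theorems.GeneratorObstructions.PowGenDegreeQP

open MvPolynomial
open Literature.NumberTheory.DiophantineGeometry Literature.Computability.AlgebraicComplexity

-- `Summit.ValiantsHypothesis.ValiantsHypothesis.…` is the tree's mandated single-conjunct layout.
set_option linter.dupNamespace false

noncomputable section

variable {σ : Type*} [Fintype σ] [LinearOrder σ]

omit [Fintype σ] in
/-- **A fundamental weight `-2·𝟙_{≥ t}` admits no splitting into two nonzero even antitone nonpositive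
weights**: if `χ₁ + χ₂ = -2·𝟙_{≥ t}` with `χᵢ ≤ 0` entrywise, all entries even, and `χᵢ` antitone,
then `χ₁ = 0` or `χ₂ = 0`. [folklore] -/
theorem eq_zero_or_eq_zero_of_add_eq_fund (t : σ) {χ₁ χ₂ : Weight σ}
    (h : χ₁ + χ₂ = fun v => if t ≤ v then (-2 : ℤ) else 0)
    (h₁le : ∀ v, χ₁ v ≤ 0) (h₂le : ∀ v, χ₂ v ≤ 0)
    (h₁ev : ∀ v, Even (χ₁ v)) (h₂ev : ∀ v, Even (χ₂ v))
    (h₁anti : Antitone χ₁) (h₂anti : Antitone χ₂) : χ₁ = 0 ∨ χ₂ = 0 := by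
  -- entrywise: below `t` both vanish; at `u ≥ t` one is `-2` and the other `0`
  have hv : ∀ v, χ₁ v + χ₂ v = if t ≤ v then (-2 : ℤ) else 0 := fun v => by
    have := congr_fun h v; simpa using this
  by_cases h1t : χ₁ t = 0
  · -- then `χ₁` vanishes at `t`, hence (antitone, nonpositive) on all `v ≤ t`... and for `v ≥ t`,
    -- `χ₁ v ≤ χ₁ t = 0` could be `-2`; but then `χ₂ v = 0` while `χ₂ t = -2`: contradiction with
    -- antitone `χ₂`.  So `χ₁ v = 0` for `v ≥ t` as well.
    left
    funext v
    by_cases htv : t ≤ v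
    · have h2t : χ₂ t = -2 := by have := hv t; rw [if_pos le_rfl, h1t] at this; omega
      have hsum := hv v
      rw [if_pos htv] at hsum
      have h2v : χ₂ v ≤ χ₂ t := h₂anti htv
      rw [h2t] at h2v
      obtain ⟨r, hr⟩ := h₁ev v
      have := h₁le v
      show χ₁ v = 0
      omega
    · have hsum := hv v
      rw [if_neg htv] at hsum
      have := h₁le v
      have := h₂le v
      show χ₁ v = 0
      omega
  · -- `χ₁ t ≠ 0`, so `χ₁ t = -2` and `χ₂ t = 0`; symmetric argument gives `χ₂ = 0`
    right
    have hsumt := hv t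
    rw [if_pos le_rfl] at hsumt
    obtain ⟨r, hr⟩ := h₁ev t
    have h1t' : χ₁ t = -2 := by have := h₁le t; have := h₂le t; omega
    have h2t : χ₂ t = 0 := by omega
    funext v
    by_cases htv : t ≤ v
    · have hsum := hv v
      rw [if_pos htv] at hsum
      have h1v : χ₁ v ≤ χ₁ t := h₁anti htv
      rw [h1t'] at h1v
      obtain ⟨r', hr'⟩ := h₂ev v
      have := h₂le v
      show χ₂ v = 0
      omega
    · have hsum := hv v
      rw [if_neg htv] at hsum
      have := h₁le v
      have := h₂le v
      show χ₂ v = 0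
      omega

/-- **The weight `0` is (degenerately) a generator type**: `HWV_0` contains the class of `1`, and no
splitting `0 = χ₁ + χ₂` into two nonzero OCCURRING weights exists (occurring weights are entrywise
`≤ 0`), so the quotient at `χ = 0` is `HWV_0 ≠ 0`. [folklore] -/
theorem finrank_quotient_zero_ne_zero (f : MvPolynomial σ ℂ) {m : ℕ} (hm : m ≠ 0) :
    Module.finrank ℂ (↥(highestWeightSpace (orbitCoordRep f m) 0) ⧸
      Submodule.comap (highestWeightSpace (orbitCoordRep f m) 0).subtype
        (⨆ p : Weight σ × Weight σ, ⨆ (_ : p.1 + p.2 = 0 ∧ p.1 ≠ 0 ∧ p.2 ≠ 0),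
          highestWeightSpace (orbitCoordRep f m) p.1 * highestWeightSpace (orbitCoordRep f m) p.2)) ≠
      0 := by
  classical
  haveI : Infinite ℂ := CharZero.infinite ℂ
  haveI : IsDomain (OrbitCoordRing f m) := isDomain_orbitCoordRing f m
  have h1mem : (1 : OrbitCoordRing f m) ∈ highestWeightSpace (orbitCoordRep f m) 0 := by
    intro g _
    rw [orbitCoordRep_apply, map_one]
    simp [weightChar]
  have hne : highestWeightSpace (orbitCoordRep f m) 0 ≠ ⊥ :=
    (Submodule.ne_bot_iff _).mpr ⟨1, h1mem, one_ne_zero⟩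
  refine finrank_quotient_ne_zero_of_atom f hm hne fun χ₁ χ₂ hsum hne₁ _ => ?_
  by_contra hboth
  push Not at hboth
  obtain ⟨hocc₁, hocc₂⟩ := hboth
  have hocc₁' : HasHighestWeight (orbitCoordRep f m) χ₁ := hocc₁
  have hocc₂' : HasHighestWeight (orbitCoordRep f m) χ₂ := hocc₂
  obtain ⟨hle₁, -⟩ := nonpos_and_exists_size_eq_of_hasHighestWeight_orbitCoordRep f hocc₁'
  obtain ⟨hle₂, -⟩ := nonpos_and_exists_size_eq_of_hasHighestWeight_orbitCoordRep f hocc₂'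
  apply hne₁
  funext v
  have h := congr_fun hsum v
  simp only [Pi.add_apply, Pi.zero_apply] at h
  have := hle₁ v
  have := hle₂ v
  show χ₁ v = 0
  omega

/-- **Generator types of the orbit closure of a full-rank quadric are exactly `0` and the
fundamental weights** (over `ℂ`): if `h₀ · f = ∑_u c_u X_u²` with all `c_u ≠ 0`, then `γ_χ(f) ≠ 0`
iff `χ = 0` (degenerate: the constants) or `χ = -2·𝟙_{≥ t}` for some letter `t` (the principal minor
of the Gram matrix on `{u ≥ t}`, degree `#{u ≥ t}`).  Goodman–Wallach §5.7
(`k[Sym²]^U = k[Δ_1,…,Δ_N]`); Vinberg–Kimel'fel'd 1978. [folklore] -/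
theorem genType_iff_fundamental_of_linSubstRep_eq_diagonal (f : MvPolynomial σ ℂ)
    (h₀ : GL σ ℂ) (c : σ → ℂ) (hc : ∀ u, c u ≠ 0)
    (h : linSubstRep σ ℂ h₀ f = ∑ u, c u • (X u : MvPolynomial σ ℂ) ^ 2) (χ : Weight σ) :
    Module.finrank ℂ (↥(highestWeightSpace (orbitCoordRep f 2) χ) ⧸
      Submodule.comap (highestWeightSpace (orbitCoordRep f 2) χ).subtype
        (⨆ p : Weight σ × Weight σ, ⨆ (_ : p.1 + p.2 = χ ∧ p.1 ≠ 0 ∧ p.2 ≠ 0),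
          highestWeightSpace (orbitCoordRep f 2) p.1 * highestWeightSpace (orbitCoordRep f 2) p.2)) ≠
      0 ↔ χ = 0 ∨ ∃ t : σ, χ = fun v => if t ≤ v then (-2 : ℤ) else 0 := by
  classical
  haveI : Infinite ℂ := CharZero.infinite ℂ
  have hdense := hdense_of_linSubstRep_eq_diagonal f h₀ c hc h
  have hsign := fun u => hsign_of_linSubstRep_eq_diagonal f h₀ c h u
  have hfund := hfund_of_linSubstRep_eq_diagonal f h₀ c hc h
  constructor
  · exact fun hγ => genType_eq_zero_or_fundamental hdense hsign hfund hγ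
  · rintro (rfl | ⟨t, rfl⟩)
    · exact finrank_quotient_zero_ne_zero f two_ne_zero
    have hocc : highestWeightSpace (orbitCoordRep f 2) (fun v => if t ≤ v then (-2 : ℤ) else 0) ≠ ⊥ :=
      hfund t
    refine finrank_quotient_ne_zero_of_atom f two_ne_zero hocc fun χ₁ χ₂ hsum hne₁ hne₂ => ?_
    by_contra hboth
    push Not at hboth
    obtain ⟨hocc₁, hocc₂⟩ := hboth
    have hocc₁' : HasHighestWeight (orbitCoordRep f 2) χ₁ := hocc₁
    have hocc₂' : HasHighestWeight (orbitCoordRep f 2) χ₂ := hocc₂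
    obtain ⟨hle₁, -⟩ := nonpos_and_exists_size_eq_of_hasHighestWeight_orbitCoordRep f hocc₁'
    obtain ⟨hle₂, -⟩ := nonpos_and_exists_size_eq_of_hasHighestWeight_orbitCoordRep f hocc₂'
    have hanti₁ : Antitone χ₁ := isDominant_of_hasHighestWeight_orbitCoordRep f hocc₁'
    have hanti₂ : Antitone χ₂ := isDominant_of_hasHighestWeight_orbitCoordRep f hocc₂'
    have hev₁ : ∀ v, Even (χ₁ v) := even_apply_of_occurs_of_sign hdense hsign hocc₁
    have hev₂ : ∀ v, Even (χ₂ v) := even_apply_of_occurs_of_sign hdense hsign hocc₂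
    rcases eq_zero_or_eq_zero_of_add_eq_fund t hsum hle₁ hle₂ hev₁ hev₂ hanti₁ hanti₂ with h1 | h2
    · exact hne₁ h1
    · exact hne₂ h2

/-- **Generator types of `A(Δ_2(tr X_n²))` are exactly `0` and the `n²` fundamental weights
`-2·𝟙_{≥ t}`**, `t ∈ MatIdx n` (degrees `#{u ≥ t} = 1, …, n²`). [folklore] -/
theorem genType_iff_fundamental_powFormLex_two (n : ℕ) (χ : Weight (MatIdx n)) :
    Module.finrank ℂ (↥(highestWeightSpace (orbitCoordRep (powFormLex ℂ n 2) 2) χ) ⧸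
      Submodule.comap (highestWeightSpace (orbitCoordRep (powFormLex ℂ n 2) 2) χ).subtype
        (⨆ p : Weight (MatIdx n) × Weight (MatIdx n), ⨆ (_ : p.1 + p.2 = χ ∧ p.1 ≠ 0 ∧ p.2 ≠ 0),
          highestWeightSpace (orbitCoordRep (powFormLex ℂ n 2) 2) p.1 *
            highestWeightSpace (orbitCoordRep (powFormLex ℂ n 2) 2) p.2)) ≠ 0 ↔
      χ = 0 ∨ ∃ t : MatIdx n, χ = fun v => if t ≤ v then (-2 : ℤ) else 0 := by
  obtain ⟨h₀, hh₀⟩ := exists_gl_powFormLex_two_eq_diagonal ℂ n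
  exact genType_iff_fundamental_of_linSubstRep_eq_diagonal (powFormLex ℂ n 2) h₀ _
    (fun u => by split_ifs <;> norm_num) hh₀ χ

end

end Summit.ValiantsHypothesis.ValiantsHypothesis.Theorems.GeneratorObstructions.PowGenDegreeQP
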